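import Mathlib.FieldTheory.Finite.Basic
import Mathlib.RingTheory.Ideal.Quotient.Basic
import Mathlib.Algebra.Polynomial.Roots
import HarnessLib

/-!
# Roots of an integer polynomial modulo `ℓ` and fixed points of a Frobenius

Route `ResidualThetaTransportAtTwo`, crux K0⁺ `HeckeThetaPartnerAdicAtTwo` (stmt-BirchSwinnertonDyer-20690),
helper §R of the line "proof from print".  THEOREMS ONLY (no definition, no named fact, no `sorry`).

* `mem_range_castHom_iff_pow_eq` — in a field of characteristic `ℓ`, `x^ℓ = x` iff `x` comes from
  `𝔽_ℓ` (the `ℓ` elements of `𝔽_ℓ` exhaust the roots of `X^ℓ − X`);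
* `card_roots_zmod_eq_card_filter_fixed` — **Dedekind's recipe**: let `R` be a domain, `Q` a maximal
  ideal with `ℓ ∈ Q`, `h ∈ ℤ[X]` monic splitting in `R` with roots pairwise distinct modulo `Q`, and
  `φ : R → R` a ring endomorphism with `φ(x) ≡ x^ℓ (mod Q)` (an arithmetic Frobenius at `Q`).  Then
  the number of roots of `h` in `𝔽_ℓ` equals the number of roots `θ` of `h` in `R` with `φ θ = θ`
  (a root `θ̄ ∈ R/Q` lies in `𝔽_ℓ` iff `θ̄^ℓ = θ̄` iff `φθ ≡ θ`, iff `φθ = θ` as `φ` permutes the roots).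
-/

set_option autoImplicit false
set_option linter.dupNamespace false

noncomputable section

open Polynomial

namespace Summit.BirchSwinnertonDyer.BirchSwinnertonDyer.Theorems.HeckeThetaPartner

/-- **`x^ℓ = x` iff `x ∈ 𝔽_ℓ`** in a field of characteristic `ℓ`. [folklore] -/
theorem mem_range_castHom_iff_pow_eq {F : Type*} [Field F] (ℓ : ℕ) [Fact ℓ.Prime] [CharP F ℓ] (x : F) :
    x ∈ Set.range (ZMod.castHom (dvd_refl ℓ) F) ↔ x ^ ℓ = x := by
  classical
  set ι := ZMod.castHom (dvd_refl ℓ) F with hι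
  constructor
  · rintro ⟨a, rfl⟩
    rw [← map_pow, ZMod.pow_card]
  · intro hx
    have h1 : 1 < ℓ := (Fact.out : ℓ.Prime).one_lt
    set g : F[X] := X ^ ℓ - X with hg
    have hg0 : g ≠ 0 := FiniteField.X_pow_card_sub_X_ne_zero F h1
    have hdeg : g.natDegree = ℓ := FiniteField.X_pow_card_sub_X_natDegree_eq F h1
    set T : Multiset F := (Finset.univ : Finset (ZMod ℓ)).val.map ι with hT
    have hTle : T ≤ g.roots := by
      rw [Multiset.le_iff_subset (Multiset.Nodup.map ι.injective Finset.univ.nodup)]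
      intro y hy
      obtain ⟨a, -, rfl⟩ := Multiset.mem_map.mp hy
      rw [mem_roots hg0, IsRoot.def, hg, eval_sub, eval_pow, eval_X, ← map_pow, ZMod.pow_card, sub_self]
    have hcard : g.roots.card ≤ T.card := by
      rw [hT, Multiset.card_map, Finset.card_val, Finset.card_univ, ZMod.card, ← hdeg]
      exact card_roots' g
    have heq : T = g.roots := Multiset.eq_of_le_of_card_le hTle hcard
    have hx' : x ∈ g.roots := by
      rw [mem_roots hg0, IsRoot.def, hg, eval_sub, eval_pow, eval_X, hx, sub_self]
    rw [← heq] at hx'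
    obtain ⟨a, -, rfl⟩ := Multiset.mem_map.mp hx'
    exact ⟨a, rfl⟩

open scoped Classical in
/-- **Roots modulo `ℓ` ↔ roots fixed by Frobenius.**  `R` a domain, `Q` maximal with `ℓ ∈ Q`,
`h ∈ ℤ[X]` monic with `deg h` roots in `R`, pairwise incongruent modulo `Q`; `φ : R →+* R` with
`φ x ≡ x^ℓ (mod Q)`.  Then `#{a ∈ 𝔽_ℓ : h(a) = 0} = #{θ : h(θ) = 0, φ θ = θ}`
(Dedekind; e.g. Marcus, *Number Fields*, Ch. 4, Thm. 33 and its proof). [folklore] -/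
theorem card_roots_zmod_eq_card_filter_fixed {R : Type*} [CommRing R] [IsDomain R] (Q : Ideal R)
    [hQ : Q.IsMaximal] (ℓ : ℕ) [Fact ℓ.Prime] (hℓ : (ℓ : R) ∈ Q) (h : ℤ[X]) (hmon : h.Monic)
    (hroots : (h.map (Int.castRingHom R)).roots.card = h.natDegree)
    (hdist : ∀ θ ∈ (h.map (Int.castRingHom R)).roots, ∀ θ' ∈ (h.map (Int.castRingHom R)).roots,
      θ - θ' ∈ Q → θ = θ')
    (φ : R →+* R) (hφ : ∀ x, φ x - x ^ ℓ ∈ Q) :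
    (h.map (Int.castRingHom (ZMod ℓ))).roots.toFinset.card =
      ((h.map (Int.castRingHom R)).roots.toFinset.filter (fun θ => φ θ = θ)).card := by
  classical
  -- the residue field and `𝔽_ℓ ⊆ R/Q`
  letI := Ideal.Quotient.field Q
  set π := Ideal.Quotient.mk Q with hπ
  have hℓ0 : (ℓ : R ⧸ Q) = 0 := by
    rw [← map_natCast π, Ideal.Quotient.eq_zero_iff_mem]; exact hℓ
  haveI : CharP (R ⧸ Q) ℓ := (CharP.charP_iff_prime_eq_zero Fact.out).mpr hℓ0
  set ι := ZMod.castHom (dvd_refl ℓ) (R ⧸ Q) with hι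
  -- the roots in `R`
  set hR := h.map (Int.castRingHom R) with hhR
  set S := hR.roots with hS
  have hmonR : hR.Monic := hmon.map _
  have hprod : (S.map fun a => X - C a).prod = hR :=
    prod_multiset_X_sub_C_of_monic_of_roots_card_eq hmonR (by rw [hroots, hhR, hmon.natDegree_map])
  -- reduction: `h mod Q = ∏ (X - π θ)` and `h mod Q = (h mod ℓ).map ι`
  set hF := h.map (Int.castRingHom (R ⧸ Q)) with hhF
  have hF_eq : hF = hR.map π := by
    rw [hhF, hhR, Polynomial.map_map, RingHom.ext_int ((π).comp (Int.castRingHom R)) (Int.castRingHom (R ⧸ Q))]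
  have hF_eq' : hF = (h.map (Int.castRingHom (ZMod ℓ))).map ι := by
    rw [hhF, Polynomial.map_map, RingHom.ext_int (ι.comp (Int.castRingHom (ZMod ℓ))) (Int.castRingHom (R ⧸ Q))]
  have hF_roots : hF.roots = S.map π := by
    rw [hF_eq, ← hprod, Polynomial.map_multiset_prod, Multiset.map_map]
    have : ((fun a => X - C a) ∘ π : R → (R ⧸ Q)[X]) = (Polynomial.map π ∘ fun a => X - C a) := by
      funext a; simp
    rw [← this, ← Multiset.map_map, roots_multiset_prod_X_sub_C]
  have hF0 : hF ≠ 0 := (hmon.map _).ne_zero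
  have hZ0 : h.map (Int.castRingHom (ZMod ℓ)) ≠ 0 := (hmon.map _).ne_zero
  -- `φ` permutes the roots, and `φ` fixes `ℤ`
  have hmapφ : hR.map φ = hR := by
    rw [hhR, Polynomial.map_map, RingHom.ext_int (φ.comp (Int.castRingHom R)) (Int.castRingHom R)]
  have hφroot : ∀ θ ∈ S, φ θ ∈ S := by
    intro θ hθ
    rw [hS, mem_roots hmonR.ne_zero, IsRoot.def] at hθ ⊢
    have h1 : (hR.map φ).eval (φ θ) = 0 := by rw [eval_map, eval₂_hom, hθ, map_zero]
    rwa [hmapφ] at h1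
  -- (b) for a root `θ`: `π θ ∈ 𝔽_ℓ ↔ φ θ = θ`
  have hb : ∀ θ ∈ S, (π θ ∈ Set.range ι ↔ φ θ = θ) := by
    intro θ hθ
    rw [mem_range_castHom_iff_pow_eq ℓ, ← map_pow]
    have h1 : π (θ ^ ℓ) = π (φ θ) := by
      rw [eq_comm, hπ, Ideal.Quotient.eq]; exact hφ θ
    rw [h1]
    constructor
    · intro h2
      have h3 : φ θ - θ ∈ Q := by rw [← Ideal.Quotient.eq]; exact h2
      exact hdist _ (hφroot θ hθ) θ hθ h3
    · intro h2; rw [h2]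
  -- compare images in `R/Q`
  set A := (h.map (Int.castRingHom (ZMod ℓ))).roots.toFinset with hA
  set B := S.toFinset.filter (fun θ => φ θ = θ) with hB
  have himg : A.image ι = B.image π := by
    ext y
    simp only [Finset.mem_image, hA, hB, Finset.mem_filter, Multiset.mem_toFinset]
    constructor
    · rintro ⟨a, ha, rfl⟩
      have hroot : ι a ∈ hF.roots := by
        rw [mem_roots hF0, IsRoot.def, hF_eq', eval_map, eval₂_hom]
        rw [mem_roots hZ0, IsRoot.def] at ha
        rw [ha, map_zero]
      rw [hF_roots, Multiset.mem_map] at hroot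
      obtain ⟨θ, hθ, hθa⟩ := hroot
      exact ⟨θ, ⟨hθ, (hb θ hθ).mp ⟨a, hθa.symm⟩⟩, hθa⟩
    · rintro ⟨θ, ⟨hθ, hfix⟩, rfl⟩
      obtain ⟨a, ha⟩ := (hb θ hθ).mpr hfix
      refine ⟨a, ?_, ha⟩
      have hroot : π θ ∈ hF.roots := by rw [hF_roots]; exact Multiset.mem_map_of_mem _ hθ
      rw [← ha, mem_roots hF0, IsRoot.def, hF_eq', eval_map, eval₂_hom, map_eq_zero_iff ι ι.injective] at hroot
      rw [mem_roots hZ0, IsRoot.def]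
      exact hroot
  have hinjB : Set.InjOn π B := by
    intro θ hθ θ' hθ' hh
    simp only [hB, Finset.coe_filter, Multiset.mem_toFinset, Set.mem_setOf_eq] at hθ hθ'
    exact hdist θ hθ.1 θ' hθ'.1 (by rw [← Ideal.Quotient.eq]; exact hh)
  rw [← Finset.card_image_of_injective A ι.injective, himg, Finset.card_image_of_injOn hinjB]

end Summit.BirchSwinnertonDyer.BirchSwinnertonDyer.Theorems.HeckeThetaPartner

end
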